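import Mathlib.Analysis.InnerProductSpace.GramSchmidtOrtho
import Mathlib.Analysis.InnerProductSpace.PiL2
import Mathlib.LinearAlgebra.Dimension.OrzechProperty
import Mathlib.LinearAlgebra.Basis.VectorSpace
import Mathlib.RingTheory.Noetherian.Basic
import Mathlib.Data.Finset.Sort
import HarnessLib

/-!
# André's algebraicity criterion over `ℚ`, I: the determinant of the jump functionals
# (Chambert-Loir, Sém. Bourbaki 886, §6.3 and (6.3.1), for `K = ℚ`; proofs only)

Topic `Literature/NumberTheory/Transcendental`. First of three files proving, for `K = ℚ`, the
algebraicity criterion of Y. André (*Sur la conjecture des `p`-courbures de Grothendieck–Katz et un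
problème de Dwork*, 2004, Thm. 2.3.1) in the form of A. Chambert-Loir, *Théorèmes d'algébricité en
géométrie diophantienne*, Sém. Bourbaki 886, Astérisque 282 (2002), Thm. 6.2 (first part) — the
criterion through which J.-B. Bost (*Algebraic leaves of algebraic foliations over number fields*,
Publ. Math. IHÉS 93 (2001), Thm. 2.3 and Cor. 2.5) proves Faltings' isogeny theorem for elliptic
curves over `ℚ` without Faltings' finiteness theorems (the tree's named fact
`WeierstrassCurve.isIsogenous_iff_frobeniusTrace_eq`).

Chambert-Loir's proof (§6.3): for `y ∈ K⟦x⟧` not algebraic, the evaluation map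
`φ : E_{d,D} → K⟦x⟧`, `P ↦ P(x, y(x))` on polynomials of bidegree `≤ (d, D)` is injective;
filtering `K⟦x⟧` by the order of vanishing at `0`, the filtered slope inequality (Prop. 5.10) reads
`0 ≤ Σₙ rk(E⁽ⁿ⁾/E⁽ⁿ⁺¹⁾) h(φ⁽ⁿ⁾)` (6.3.1). Over `K = ℚ` with `E_{d,D}` the standard Euclidean
lattice `ℤ^N`, this inequality is an elementary statement about one determinant, and that is
what this file proves, in the following abstract form. Let `V = ℝ^ι` (`EuclideanSpace ℝ ι`,
`N = |ι|`) and let `w : ℕ → V` be the sequence of "rows" (`w m` is the functional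
`P ↦ [xᵐ] P(x, y(x))` written as a vector; in the application its coordinates are rational).
Assume the rows separate points (`φ` injective). Then:

* the **row spans** `span ℝ {w m' : m' < m}` form an increasing chain of subspaces, eventually
  `⊤` (`exists_span_eq_top`); `m` is a **jump** when `w m ∉ span ℝ {w m' : m' < m}` — these are
  exactly the indices `n` with `E⁽ⁿ⁾ ≠ E⁽ⁿ⁺¹⁾` (`E⁽ⁿ⁾` = the orthogonal of the `n`-th row span),
  and there are exactly `N` of them, enumerated increasingly by a **jump sequence**
  `n : Fin N → ℕ` (`exists_jumpSeq`; so `Σⱼ nⱼ ≥ 0 + 1 + ⋯ + (N-1)`,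
  `sum_fin_le_sum_of_strictMono` — Chambert-Loir (6.8.2));
* the `N` jump rows form a basis of `V` (`linearIndependent_jumpRow`), and in the orthonormal
  basis obtained from them by Gram–Schmidt the matrix of the jump functionals is triangular, so
  that (Mathlib's `gramSchmidtOrthonormalBasis_det`) the determinant of the jump rows in the
  standard basis has absolute value `Πⱼ |⟪bⱼ, w nⱼ⟫|` with `bⱼ` a unit vector killed by every
  row of index `< nⱼ`; hence **`|det| ≤ Πⱼ β nⱼ`** whenever `|⟪w m, v⟫| ≤ β m ‖v‖` for all `v`
  killed by the rows of index `< m` (`abs_det_jumpRow_le`) — the archimedean bound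
  `h_∞(φ⁽ⁿ⁾) ≤ log β n` of (6.5.1)/(6.6.1) entering (6.3.1);
* if the rows are rational with denominators, `Den m · w m ∈ ℤ^ι`, then the determinant is a
  non-zero rational number with denominator dividing `Πⱼ Den nⱼ`, so
  **`1 ≤ (Πⱼ Den nⱼ) · Πⱼ β nⱼ`** (`one_le_prod_den_mul_prod_bound`,
  `exists_strictMono_one_le_prod`) — the finite places' contribution and the product formula
  in (6.3.1);
* finally the passage from rational to real test vectors (`separating_of_rational`): if no
  non-zero RATIONAL vector is killed by all rows then no non-zero real vector is.

## Sources

* A. Chambert-Loir, *Théorèmes d'algébricité en géométrie diophantienne (d'après J.-B. Bost,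
  Y. André, D. & G. Chudnovsky)*, Sém. Bourbaki 886 (2000–01), Astérisque 282 (2002), 175–209
  = arXiv:math/0103192: §5.9–5.10 (slope inequality), §6.1–6.3, (6.3.1), (6.8.2).
  [ChambertLoir2002Bourbaki]
* Y. André, *Sur la conjecture des `p`-courbures de Grothendieck–Katz et un problème de Dwork*,
  in: Geometric aspects of Dwork theory (2004), Thm. 2.3.1. [Andre2004pCourbures]
* J.-B. Bost, Publ. Math. IHÉS 93 (2001), 161–221, §2.2–2.3, §4. [Bost2001AlgebraicLeaves]

## Design notes

Pure linear algebra over `ℝ`; theorems only (no definitions, no named facts; nothing is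
asserted): the row spans, jumps and the jump sequence are written out (`span ℝ (w '' Set.Iio m)`,
`w m ∉ span ℝ (w '' Set.Iio m)`, a strictly increasing `n : Fin N → ℕ` enumerating the jumps).
The slope formalism of Bost/Chambert-Loir (hermitian vector bundles on `Spec ℤ`, arithmetic
degrees) is replaced, for `K = ℚ`, by Gram–Schmidt: the adapted orthonormal basis makes the jump
matrix triangular, which is the content of `d̂eg(ℤ^N) = Σ d̂eg(gr)` here.
-/

noncomputable section

open Module Submodule Finset InnerProductSpace
open scoped RealInnerProductSpace

namespace Literature.NumberTheory.Transcendental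

namespace AndreCriterion

variable {ι : Type*} (w : ℕ → EuclideanSpace ℝ ι)

/-! ### The chain of row spans and its jumps -/

/-- The `0`-th row span is `0`. [folklore] -/
theorem span_image_Iio_zero : span ℝ (w '' Set.Iio 0) = ⊥ := by
  simp

/-- `{k | k < m + 1} = {m} ∪ {k | k < m}`. [folklore] -/
theorem Iio_succ_eq_insert (m : ℕ) : Set.Iio (m + 1) = insert m (Set.Iio m) := by
  ext k
  simp only [Set.mem_Iio, Set.mem_insert_iff]
  omega

/-- The `(m+1)`-st row span is `ℝ w m +` the `m`-th. [folklore] -/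
theorem span_image_Iio_succ (m : ℕ) :
    span ℝ (w '' Set.Iio (m + 1)) = (ℝ ∙ w m) ⊔ span ℝ (w '' Set.Iio m) := by
  rw [Iio_succ_eq_insert, Set.image_insert_eq, span_insert]

/-- The chain of row spans is increasing. [folklore] -/
theorem span_image_Iio_mono : Monotone fun m => span ℝ (w '' Set.Iio m) := fun _ _ h =>
  span_mono (Set.image_mono (Set.Iio_subset_Iio h))

/-- Earlier rows lie in later row spans. [folklore] -/
theorem mem_span_image_Iio {m m' : ℕ} (h : m' < m) : w m' ∈ span ℝ (w '' Set.Iio m) :=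
  subset_span ⟨m', h, rfl⟩

/-- At a non-jump the row span does not change. [folklore] -/
theorem span_image_Iio_succ_of_mem {m : ℕ} (h : w m ∈ span ℝ (w '' Set.Iio m)) :
    span ℝ (w '' Set.Iio (m + 1)) = span ℝ (w '' Set.Iio m) := by
  rw [span_image_Iio_succ, sup_eq_right]
  exact (span_singleton_le_iff_mem _ _).mpr h

/-- A jump row is non-zero. [folklore] -/
theorem ne_zero_of_not_mem_span {m : ℕ} (h : w m ∉ span ℝ (w '' Set.Iio m)) : w m ≠ 0 := by
  intro h0
  apply h
  rw [h0]
  exact zero_mem _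

/-- No jumps beyond an index where the row span is everything. [folklore] -/
theorem mem_span_of_span_eq_top {M : ℕ} (hM : span ℝ (w '' Set.Iio M) = ⊤) {m : ℕ}
    (hm : M ≤ m) : w m ∈ span ℝ (w '' Set.Iio m) := by
  have h : span ℝ (w '' Set.Iio M) ≤ span ℝ (w '' Set.Iio m) := span_image_Iio_mono w hm
  apply h
  rw [hM]
  exact mem_top

/-- **The row span is spanned by its jump rows.** [folklore] -/
theorem span_image_Iio_eq_span_image_jumps (m : ℕ) :
    span ℝ (w '' Set.Iio m) =
      span ℝ (w '' {k | k < m ∧ w k ∉ span ℝ (w '' Set.Iio k)}) := by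
  induction m with
  | zero =>
    rw [span_image_Iio_zero, eq_comm, span_eq_bot]
    rintro x ⟨k, ⟨hk, _⟩, _⟩
    exact absurd hk (Nat.not_lt_zero k)
  | succ m ih =>
    by_cases h : w m ∈ span ℝ (w '' Set.Iio m)
    · have hset : {k | k < m + 1 ∧ w k ∉ span ℝ (w '' Set.Iio k)} =
          {k | k < m ∧ w k ∉ span ℝ (w '' Set.Iio k)} := by
        ext k
        simp only [Set.mem_setOf_eq]
        constructor
        · rintro ⟨hk, hj⟩
          rcases Nat.lt_succ_iff_lt_or_eq.mp hk with hk' | rfl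
          · exact ⟨hk', hj⟩
          · exact absurd h hj
        · rintro ⟨hk, hj⟩
          exact ⟨Nat.lt_succ_of_lt hk, hj⟩
      rw [span_image_Iio_succ_of_mem w h, ih, hset]
    · have hset : {k | k < m + 1 ∧ w k ∉ span ℝ (w '' Set.Iio k)} =
          insert m {k | k < m ∧ w k ∉ span ℝ (w '' Set.Iio k)} := by
        ext k
        simp only [Set.mem_setOf_eq, Set.mem_insert_iff]
        constructor
        · rintro ⟨hk, hj⟩
          rcases Nat.lt_succ_iff_lt_or_eq.mp hk with hk' | rfl
          · exact Or.inr ⟨hk', hj⟩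
          · exact Or.inl rfl
        · rintro (rfl | ⟨hk, hj⟩)
          · exact ⟨Nat.lt_succ_self _, h⟩
          · exact ⟨Nat.lt_succ_of_lt hk, hj⟩
      rw [span_image_Iio_succ, ih, hset, Set.image_insert_eq, span_insert]

/-- `Σⱼ j ≤ Σⱼ nⱼ` for a strictly increasing `n : Fin N → ℕ` (as `nⱼ ≥ j`); hence for a jump
sequence `Σⱼ nⱼ ≥ 0 + 1 + ⋯ + (N - 1) = N(N-1)/2` (Chambert-Loir (6.8.2):
`Σ n·rk(E⁽ⁿ⁾/E⁽ⁿ⁺¹⁾) ≥ ½ rk E (rk E - 1)`). (Pointwise form: the tree's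
`Literature.Analysis.TotalPositivity.le_of_strictMono_fin`.) [cite: ChambertLoir2002Bourbaki, (6.8.2)] -/
theorem sum_fin_le_sum_of_strictMono {N : ℕ} {n : Fin N → ℕ} (hn : StrictMono n) :
    ∑ j : Fin N, (j : ℕ) ≤ ∑ j, n j := by
  refine Finset.sum_le_sum fun j _ => ?_
  have key : ∀ k : ℕ, ∀ hk : k < N, k ≤ n ⟨k, hk⟩ := by
    intro k
    induction k with
    | zero => intro _; exact Nat.zero_le _
    | succ k ih =>
      intro hk
      have hlt : n ⟨k, by omega⟩ < n ⟨k + 1, hk⟩ := hn (Fin.mk_lt_mk.mpr (Nat.lt_succ_self k))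
      have := ih (by omega)
      omega
  exact key j.1 j.2

section Finite

variable [Fintype ι]

/-- At a jump the dimension of the row span goes up by one. [folklore] -/
theorem finrank_span_image_Iio_succ_of_not_mem {m : ℕ} (h : w m ∉ span ℝ (w '' Set.Iio m)) :
    finrank ℝ (span ℝ (w '' Set.Iio (m + 1))) = finrank ℝ (span ℝ (w '' Set.Iio m)) + 1 := by
  rw [span_image_Iio_succ]
  have hinf : (ℝ ∙ w m) ⊓ span ℝ (w '' Set.Iio m) = ⊥ := by
    rw [eq_bot_iff]
    intro x hx
    obtain ⟨hx1, hx2⟩ := mem_inf.mp hx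
    obtain ⟨c, rfl⟩ := mem_span_singleton.mp hx1
    by_cases hc : c = 0
    · simp [hc]
    · exfalso
      apply h
      have := smul_mem (span ℝ (w '' Set.Iio m)) c⁻¹ hx2
      rwa [smul_smul, inv_mul_cancel₀ hc, one_smul] at this
  have key := finrank_sup_add_finrank_inf_eq (ℝ ∙ w m) (span ℝ (w '' Set.Iio m))
  rw [hinf, finrank_bot, add_zero, finrank_span_singleton (ne_zero_of_not_mem_span w h)] at key
  omega

/-- **If the rows separate points, some row span is everything** (the chain is stationary by
noetherianity, and a vector orthogonal to all rows is zero). [cite: ChambertLoir2002Bourbaki, §6.3] -/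
theorem exists_span_eq_top (hw : ∀ v, (∀ m, ⟪w m, v⟫ = 0) → v = 0) :
    ∃ M, span ℝ (w '' Set.Iio M) = ⊤ := by
  obtain ⟨M, hM⟩ := (monotone_stabilizes_iff_noetherian.mpr
    (inferInstance : IsNoetherian ℝ (EuclideanSpace ℝ ι)))
      ⟨fun m => span ℝ (w '' Set.Iio m), span_image_Iio_mono w⟩
  refine ⟨M, ?_⟩
  have hall : ∀ m, w m ∈ span ℝ (w '' Set.Iio M) := by
    intro m
    rcases lt_or_ge m M with h | h
    · exact mem_span_image_Iio w h
    · have : span ℝ (w '' Set.Iio M) = span ℝ (w '' Set.Iio (m + 1)) := hM (m + 1) (by omega)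
      rw [this]
      exact mem_span_image_Iio w (Nat.lt_succ_self m)
  rw [← Submodule.orthogonal_eq_bot_iff, eq_bot_iff]
  intro v hv
  rw [mem_bot]
  exact hw v fun m => inner_right_of_mem_orthogonal (hall m) hv

/-- **The dimension of the `M`-th row span is the number of jumps below `M`** (telescoping).
[cite: ChambertLoir2002Bourbaki, §6.8, proof of (6.8.2)] -/
theorem finrank_span_image_Iio_eq_card
    [DecidablePred fun k => w k ∉ span ℝ (w '' Set.Iio k)] (M : ℕ) :
    finrank ℝ (span ℝ (w '' Set.Iio M)) =
      ((range M).filter fun k => w k ∉ span ℝ (w '' Set.Iio k)).card := by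
  induction M with
  | zero => simp
  | succ M ih =>
    rw [range_add_one, filter_insert]
    by_cases h : w M ∉ span ℝ (w '' Set.Iio M)
    · rw [if_pos h, card_insert_of_notMem (by simp), finrank_span_image_Iio_succ_of_not_mem w h,
        ih]
    · rw [if_neg h, span_image_Iio_succ_of_mem w (not_not.mp h), ih]

/-! ### The jump sequence -/

/-- **There are exactly `N = dim V` jumps, enumerated increasingly by a jump sequence**
(Chambert-Loir: `Σₙ rk(E⁽ⁿ⁾/E⁽ⁿ⁺¹⁾) = rk E`): if the `M`-th row span is everything there is a
strictly increasing `n : Fin N → ℕ` whose values are exactly the jumps.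
[cite: ChambertLoir2002Bourbaki, §6.3 and §6.8] -/
theorem exists_jumpSeq {M : ℕ} (hM : span ℝ (w '' Set.Iio M) = ⊤) :
    ∃ n : Fin (Fintype.card ι) → ℕ, StrictMono n ∧
      (∀ j, w (n j) ∉ span ℝ (w '' Set.Iio (n j))) ∧
      ∀ k, w k ∉ span ℝ (w '' Set.Iio k) → k ∈ Set.range n := by
  classical
  set J : Finset ℕ := (range M).filter fun k => w k ∉ span ℝ (w '' Set.Iio k) with hJ
  have hcard : J.card = Fintype.card ι := by
    rw [hJ, ← finrank_span_image_Iio_eq_card, hM, finrank_top, finrank_euclideanSpace]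
  refine ⟨J.orderEmbOfFin hcard, (J.orderEmbOfFin hcard).strictMono, fun j => ?_, fun k hk => ?_⟩
  · exact (mem_filter.mp (J.orderEmbOfFin_mem hcard j)).2
  · have hkM : k < M := by
      by_contra h
      exact hk (mem_span_of_span_eq_top w hM (not_lt.mp h))
    change k ∈ Set.range (J.orderEmbOfFin hcard)
    rw [J.range_orderEmbOfFin hcard, Finset.mem_coe]
    exact mem_filter.mpr ⟨mem_range.mpr hkM, hk⟩

section JumpSeq

variable {w} {N : ℕ} {n : Fin N → ℕ} (hn : StrictMono n)
  (hjump : ∀ j, w (n j) ∉ span ℝ (w '' Set.Iio (n j)))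
  (hall : ∀ k, w k ∉ span ℝ (w '' Set.Iio k) → k ∈ Set.range n)

omit [Fintype ι] in
include hn hall in
/-- The jumps below `nⱼ` are the `nᵢ`, `i < j`. [folklore] -/
theorem setOf_lt_and_jump_eq (hjump : ∀ j, w (n j) ∉ span ℝ (w '' Set.Iio (n j)))
    (j : Fin N) :
    {k | k < n j ∧ w k ∉ span ℝ (w '' Set.Iio k)} = n '' Set.Iio j := by
  ext k
  simp only [Set.mem_setOf_eq, Set.mem_image, Set.mem_Iio]
  constructor
  · rintro ⟨hk, hj⟩
    obtain ⟨i, rfl⟩ := hall k hj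
    exact ⟨i, hn.lt_iff_lt.mp hk, rfl⟩
  · rintro ⟨i, hi, rfl⟩
    exact ⟨hn hi, hjump i⟩

omit [Fintype ι] in
include hn hjump hall in
/-- The `nⱼ`-th row span is spanned by the earlier jump rows. [folklore] -/
theorem span_image_Iio_jumpSeq (j : Fin N) :
    span ℝ (w '' Set.Iio (n j)) = span ℝ ((fun i => w (n i)) '' Set.Iio j) := by
  rw [span_image_Iio_eq_span_image_jumps, setOf_lt_and_jump_eq hn hall hjump, ← Set.image_comp]
  rfl

omit [Fintype ι] in
include hall in
/-- All jump rows together span `V`. [folklore] -/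
theorem span_range_jumpRow {M : ℕ} (hM : span ℝ (w '' Set.Iio M) = ⊤) :
    span ℝ (Set.range fun i => w (n i)) = ⊤ := by
  apply eq_top_iff.mpr
  rw [← hM, span_image_Iio_eq_span_image_jumps]
  refine span_mono ?_
  rintro x ⟨k, ⟨_, hk⟩, rfl⟩
  obtain ⟨i, rfl⟩ := hall k hk
  exact ⟨i, rfl⟩

end JumpSeq

/-! ### The Gram–Schmidt basis of the jump rows and the determinant -/

/-- `dim V = N` in the form consumed by `gramSchmidtOrthonormalBasis`. [folklore] -/
theorem finrank_eq_card_fin :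
    finrank ℝ (EuclideanSpace ℝ ι) = Fintype.card (Fin (Fintype.card ι)) := by
  rw [finrank_euclideanSpace, Fintype.card_fin]

section Det

variable {w} {n : Fin (Fintype.card ι) → ℕ} (hn : StrictMono n)
  (hjump : ∀ j, w (n j) ∉ span ℝ (w '' Set.Iio (n j)))
  (hall : ∀ k, w k ∉ span ℝ (w '' Set.Iio k) → k ∈ Set.range n)
  {M : ℕ} (hM : span ℝ (w '' Set.Iio M) = ⊤)

include hall hM in
/-- **The jump rows are linearly independent** (they are `N = dim V` vectors spanning `V`).
[folklore] -/
theorem linearIndependent_jumpRow : LinearIndependent ℝ fun i => w (n i) :=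
  linearIndependent_of_top_le_span_of_card_eq_finrank (span_range_jumpRow hall hM).ge
    (by rw [finrank_euclideanSpace, Fintype.card_fin])

include hn hjump hall in
/-- **The `j`-th Gram–Schmidt vector of the jump rows (in increasing order of the jumps) is
killed by every row of index `< nⱼ`**: it is orthogonal to the earlier jump rows, which span the
`nⱼ`-th row span. This is the adapted basis in which the jump matrix is triangular.
[cite: ChambertLoir2002Bourbaki, §5.10] -/
theorem inner_row_gramSchmidt_eq_zero (j : Fin (Fintype.card ι)) {m' : ℕ} (hm' : m' < n j) :
    ⟪w m', gramSchmidtOrthonormalBasis (finrank_eq_card_fin (ι := ι)) (fun i => w (n i)) j⟫ = 0 := by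
  set b := gramSchmidtOrthonormalBasis (finrank_eq_card_fin (ι := ι)) (fun i => w (n i)) with hb
  have hmem : w m' ∈ span ℝ ((fun i => w (n i)) '' Set.Iio j) := by
    rw [← span_image_Iio_jumpSeq hn hjump hall j]
    exact mem_span_image_Iio w hm'
  have hle : span ℝ ((fun i => w (n i)) '' Set.Iio j) ≤ LinearMap.ker (innerₛₗ ℝ (b j)) := by
    rw [span_le]
    rintro x ⟨i, hi, rfl⟩
    rw [SetLike.mem_coe, LinearMap.mem_ker, innerₛₗ_apply_apply]
    exact gramSchmidtOrthonormalBasis_inv_triangular _ _ hi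
  have := hle hmem
  rw [LinearMap.mem_ker, innerₛₗ_apply_apply] at this
  rwa [real_inner_comm]

include hn hjump hall in
/-- **The archimedean bound on the jump determinant** (Chambert-Loir (6.3.1) with (6.6.1) at the
infinite place, for `K = ℚ`): if `|⟪w m, v⟫| ≤ β m ‖v‖` for every `v` killed by the rows of
index `< m`, then the determinant of the jump rows in the standard orthonormal basis of `ℝ^ι`
(reindexed by `Fin N`) is at most `Πⱼ β nⱼ` in absolute value. Proof: change to the Gram–Schmidt
basis (determinant `±1`), where the determinant is `Πⱼ ⟪bⱼ, w nⱼ⟫` (Mathlib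
`gramSchmidtOrthonormalBasis_det`) with `bⱼ` a unit vector killed by the rows of index `< nⱼ`.
[cite: ChambertLoir2002Bourbaki, (6.3.1) and Prop. 5.10] -/
theorem abs_det_jumpRow_le (β : ℕ → ℝ)
    (hβ : ∀ m v, (∀ m' < m, ⟪w m', v⟫ = 0) → |⟪w m, v⟫| ≤ β m * ‖v‖) :
    |((EuclideanSpace.basisFun ι ℝ).reindex (Fintype.equivFin ι)).toBasis.det
        (fun i => w (n i))| ≤ ∏ j, β (n j) := by
  set e := (EuclideanSpace.basisFun ι ℝ).reindex (Fintype.equivFin ι) with he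
  set b := gramSchmidtOrthonormalBasis (finrank_eq_card_fin (ι := ι)) (fun i => w (n i)) with hb
  have h1 : e.toBasis.det (fun i => w (n i)) =
      e.toBasis.det b * b.toBasis.det (fun i => w (n i)) := by
    have := AlternatingMap.eq_smul_basis_det b.toBasis e.toBasis.det
    conv_lhs => rw [this]
    rw [AlternatingMap.smul_apply, smul_eq_mul, OrthonormalBasis.coe_toBasis]
  have h2 : |e.toBasis.det b| = 1 := by
    rcases e.det_to_matrix_orthonormalBasis_real b with h | h <;> rw [h] <;> simp
  have h3 : b.toBasis.det (fun i => w (n i)) = ∏ j, ⟪b j, w (n j)⟫ :=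
    gramSchmidtOrthonormalBasis_det _ _
  rw [h1, abs_mul, h2, one_mul, h3, Finset.abs_prod]
  refine Finset.prod_le_prod (fun j _ => abs_nonneg _) fun j _ => ?_
  rw [real_inner_comm]
  have hnorm : ‖b j‖ = 1 := b.orthonormal.1 j
  have := hβ (n j) (b j) fun m' hm' => inner_row_gramSchmidt_eq_zero hn hjump hall j hm'
  rw [hnorm, mul_one] at this
  exact this

include hall hM in
/-- The jump determinant is non-zero (the jump rows form a basis). [folklore] -/
theorem det_jumpRow_ne_zero :
    ((EuclideanSpace.basisFun ι ℝ).reindex (Fintype.equivFin ι)).toBasis.det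
      (fun i => w (n i)) ≠ 0 :=
  ((((EuclideanSpace.basisFun ι ℝ).reindex (Fintype.equivFin ι)).toBasis.is_basis_iff_det).mp
    ⟨linearIndependent_jumpRow hall hM, span_range_jumpRow hall hM⟩).ne_zero

omit [Fintype ι] in
/-- The entries of the jump matrix in the standard basis are the coordinates of the jump rows.
[folklore] -/
theorem toMatrix_stdBasis_apply [Fintype ι] (f : Fin (Fintype.card ι) → EuclideanSpace ℝ ι)
    (i j : Fin (Fintype.card ι)) :
    ((EuclideanSpace.basisFun ι ℝ).reindex (Fintype.equivFin ι)).toBasis.toMatrix f i j =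
      f j ((Fintype.equivFin ι).symm i) := by
  rw [Basis.toMatrix_apply, OrthonormalBasis.coe_toBasis_repr_apply,
    OrthonormalBasis.repr_reindex, EuclideanSpace.basisFun_repr]

include hall hM in
/-- **The finite places' bound on the jump determinant** (product formula): if every row has
rational coordinates with denominator `Den m ≥ 1` (`Den m · w m ∈ ℤ^ι`), then the jump
determinant `δ ≠ 0` satisfies `1 ≤ (Πⱼ Den nⱼ) · |δ|`, because `(Πⱼ Den nⱼ) · δ` is the
determinant of an integer matrix. [cite: ChambertLoir2002Bourbaki, (6.3.1) and (6.7.1)] -/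
theorem one_le_prod_den_mul_abs_det (Den : ℕ → ℕ) (hDen : ∀ m, 0 < Den m)
    (hZ : ∀ m i, ∃ z : ℤ, (Den m : ℝ) * w m i = z) :
    1 ≤ (∏ j, (Den (n j) : ℝ)) *
      |((EuclideanSpace.basisFun ι ℝ).reindex (Fintype.equivFin ι)).toBasis.det
        (fun i => w (n i))| := by
  choose z hz using hZ
  set e := (EuclideanSpace.basisFun ι ℝ).reindex (Fintype.equivFin ι) with he
  set A : Matrix (Fin (Fintype.card ι)) (Fin (Fintype.card ι)) ℝ :=
    e.toBasis.toMatrix (fun i => w (n i)) with hA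
  set Z : Matrix (Fin (Fintype.card ι)) (Fin (Fintype.card ι)) ℤ :=
    fun i j => z (n j) ((Fintype.equivFin ι).symm i) with hZdef
  have hdet : e.toBasis.det (fun i => w (n i)) = A.det := Basis.det_apply _ _
  have hAZ : A * Matrix.diagonal (fun j => (Den (n j) : ℝ)) = Z.map (Int.castRingHom ℝ) := by
    ext i j
    rw [Matrix.mul_diagonal, Matrix.map_apply, hA, he, toMatrix_stdBasis_apply, hZdef]
    simp only [eq_intCast]
    rw [← hz, mul_comm]
  have hdetZ : A.det * ∏ j, (Den (n j) : ℝ) = (Z.det : ℝ) := by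
    rw [← Matrix.det_diagonal, ← Matrix.det_mul, hAZ, Int.cast_det]
    rfl
  have hprod : (∏ j, (Den (n j) : ℝ)) ≠ 0 :=
    Finset.prod_ne_zero_iff.mpr fun j _ => Nat.cast_ne_zero.mpr (hDen _).ne'
  have hA0 : A.det ≠ 0 := by
    rw [← hdet]
    exact det_jumpRow_ne_zero hall hM
  have hZ0 : Z.det ≠ 0 := by
    intro h0
    have : A.det * ∏ j, (Den (n j) : ℝ) = 0 := by rw [hdetZ, h0, Int.cast_zero]
    exact mul_ne_zero hA0 hprod this
  have h1 : (1 : ℝ) ≤ |(Z.det : ℝ)| := by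
    rw [← Int.cast_abs, ← Int.cast_one, Int.cast_le]
    exact Int.one_le_abs hZ0
  calc (1 : ℝ) ≤ |(Z.det : ℝ)| := h1
    _ = |A.det * ∏ j, (Den (n j) : ℝ)| := by rw [hdetZ]
    _ = (∏ j, (Den (n j) : ℝ)) * |A.det| := by
        rw [abs_mul, mul_comm, abs_of_nonneg (Finset.prod_nonneg fun j _ => Nat.cast_nonneg _)]
    _ = (∏ j, (Den (n j) : ℝ)) * |e.toBasis.det (fun i => w (n i))| := by rw [hdet]

include hn hjump hall hM in
/-- **Chambert-Loir's (6.3.1) for `K = ℚ`, combined**: with the archimedean bound `β` and the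
denominators `Den` as above, `1 ≤ (Πⱼ Den nⱼ) · Πⱼ β nⱼ`. [cite: ChambertLoir2002Bourbaki, (6.3.1)] -/
theorem one_le_prod_den_mul_prod_bound (β : ℕ → ℝ)
    (hβ : ∀ m v, (∀ m' < m, ⟪w m', v⟫ = 0) → |⟪w m, v⟫| ≤ β m * ‖v‖)
    (Den : ℕ → ℕ) (hDen : ∀ m, 0 < Den m) (hZ : ∀ m i, ∃ z : ℤ, (Den m : ℝ) * w m i = z) :
    1 ≤ (∏ j, (Den (n j) : ℝ)) * ∏ j, β (n j) :=
  (one_le_prod_den_mul_abs_det hall hM Den hDen hZ).trans (mul_le_mul_of_nonneg_left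
    (abs_det_jumpRow_le hn hjump hall β hβ) (Finset.prod_nonneg fun _ _ => Nat.cast_nonneg _))

end Det

/-- **The determinant inequality of André's criterion over `ℚ`** (Chambert-Loir (6.3.1) with
(6.8.2), `K = ℚ`, in elementary form). Let `w : ℕ → ℝ^ι` be rows separating the points of
`ℝ^ι`, with rational coordinates of denominators `Den m ≥ 1`, and let `β m` bound the functional
`⟪w m, ·⟫` on the vectors killed by the rows of index `< m`. Then there are indices
`n₀ < n₁ < ⋯ < n_{N-1}` (`N = |ι|`; so `Σ nⱼ ≥ N(N-1)/2`, `sum_fin_le_sum_of_strictMono`) with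
`1 ≤ (Πⱼ Den nⱼ) · (Πⱼ β nⱼ)`. [cite: ChambertLoir2002Bourbaki, (6.3.1), (6.8.2)] -/
theorem exists_strictMono_one_le_prod (hw : ∀ v, (∀ m, ⟪w m, v⟫ = 0) → v = 0) (β : ℕ → ℝ)
    (hβ : ∀ m v, (∀ m' < m, ⟪w m', v⟫ = 0) → |⟪w m, v⟫| ≤ β m * ‖v‖)
    (Den : ℕ → ℕ) (hDen : ∀ m, 0 < Den m) (hZ : ∀ m i, ∃ z : ℤ, (Den m : ℝ) * w m i = z) :
    ∃ n : Fin (Fintype.card ι) → ℕ, StrictMono n ∧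
      1 ≤ (∏ j, (Den (n j) : ℝ)) * ∏ j, β (n j) := by
  obtain ⟨M, hM⟩ := exists_span_eq_top w hw
  obtain ⟨n, hn, hjump, hall⟩ := exists_jumpSeq w hM
  exact ⟨n, hn, one_le_prod_den_mul_prod_bound hn hjump hall hM β hβ Den hDen hZ⟩

/-! ### From rational to real test vectors -/

omit [Fintype ι] in
/-- The inner product with a row of rational coordinates `q`. [folklore] -/
theorem inner_toLp_ratCast [Fintype ι] (q : ι → ℚ) (v : EuclideanSpace ℝ ι) :
    ⟪WithLp.toLp 2 (fun i => (q i : ℝ)), v⟫ = ∑ i, (q i : ℝ) * v i := by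
  rw [PiLp.inner_apply]
  refine Finset.sum_congr rfl fun i _ => ?_
  simp [mul_comm]

/-- **If no non-zero rational vector is killed by all the (rational) rows, then no non-zero real
vector is**: the rows then span `ℚ^ι` over `ℚ`, hence the standard basis vectors are rational
combinations of rows, hence the real rows span `ℝ^ι`. (The injectivity of `P ↦ P(x, y(x))` on
rational polynomials is what "`y` is not algebraic" provides; the slope inequality is applied to
the real Euclidean lattice.) [folklore] -/
theorem separating_of_rational (q : ℕ → ι → ℚ)
    (hq : ∀ u : ι → ℚ, (∀ m, ∑ i, q m i * u i = 0) → u = 0)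
    (v : EuclideanSpace ℝ ι) (hv : ∀ m, ⟪WithLp.toLp 2 (fun i => (q m i : ℝ)), v⟫ = 0) :
    v = 0 := by
  classical
  -- Step 1: the rows span `ℚ^ι`.
  have hspan : span ℚ (Set.range q) = ⊤ := by
    by_contra hne
    obtain ⟨f, hf0, hle⟩ :=
      Submodule.exists_le_ker_of_lt_top _ (lt_top_iff_ne_top.mpr hne)
    set u : ι → ℚ := fun i => f fun j => if i = j then 1 else 0 with hu
    have hfx : ∀ x : ι → ℚ, f x = ∑ i, x i * u i := by
      intro x
      rw [LinearMap.pi_apply_eq_sum_univ f x]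
      rfl
    have hu0 : u = 0 := hq u fun m => by
      rw [show ∑ i, q m i * u i = f (q m) from (hfx (q m)).symm]
      exact hle (subset_span ⟨m, rfl⟩)
    apply hf0
    refine LinearMap.ext fun x => ?_
    rw [hfx]
    simp [hu0]
  -- Step 2: the real rows span `ℝ^ι`.
  let T : (ι → ℚ) →ₗ[ℚ] EuclideanSpace ℝ ι :=
    { toFun := fun x => WithLp.toLp 2 fun i => (x i : ℝ)
      map_add' := by intro x y; ext i; simp
      map_smul' := by intro c x; ext i; simp [Rat.smul_def] }
  set W : Submodule ℝ (EuclideanSpace ℝ ι) :=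
    span ℝ (Set.range fun m => WithLp.toLp 2 fun i => (q m i : ℝ)) with hWdef
  have hTW : ∀ x, T x ∈ W := by
    have : (⊤ : Submodule ℚ (ι → ℚ)) ≤ (W.restrictScalars ℚ).comap T := by
      rw [← hspan, span_le]
      rintro _ ⟨m, rfl⟩
      change T (q m) ∈ W
      exact subset_span ⟨m, rfl⟩
    intro x
    exact this (mem_top (x := x))
  have hW : W = ⊤ := by
    refine eq_top_iff.mpr ?_
    rw [← (EuclideanSpace.basisFun ι ℝ).toBasis.span_eq, span_le]
    rintro _ ⟨i, rfl⟩
    have hT : T (fun j => if i = j then 1 else 0) = (EuclideanSpace.basisFun ι ℝ).toBasis i := by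
      rw [OrthonormalBasis.coe_toBasis, EuclideanSpace.basisFun_apply]
      ext j
      by_cases h : i = j
      · subst h; simp [T]
      · simp [T, h, Ne.symm h]
    rw [SetLike.mem_coe, ← hT]
    exact hTW _
  -- Step 3: `v` is orthogonal to `W = ⊤`.
  have hvW : W ≤ LinearMap.ker (innerₛₗ ℝ v) := by
    rw [hWdef, span_le]
    rintro _ ⟨m, rfl⟩
    rw [SetLike.mem_coe, LinearMap.mem_ker, innerₛₗ_apply_apply, real_inner_comm]
    exact hv m
  rw [hW] at hvW
  have : ⟪v, v⟫ = 0 := by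
    have := hvW (mem_top (x := v))
    rwa [LinearMap.mem_ker, innerₛₗ_apply_apply] at this
  exact inner_self_eq_zero.mp this

end Finite

end AndreCriterion

end Literature.NumberTheory.Transcendental
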